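import Summits.Ventures.Crystal3D.Theorems.StickyWulffConstantPolycrystalWulffBoundDominantCharged
import Summits.Ventures.Crystal3D.Theorems.StickyWulffConstantPolycrystalWulffBoundRungTwinFreeAllClassesCharged
import Summits.Ventures.Crystal3D.Theorems.StickyWulffConstantPolycrystalWulffBoundChargedArith

/-!
# `PolycrystalWulffBound`, line `PolyDensity`: the SHARPENED certificate-free rungs of the all-generic
# class — two lattices at generic charge `≥ 11/10`, any number of lattices at charge `≥ 3/2`
# (crux `stmt-Ventures-19482`; lane poly-p2, gen 23)

Route `StickyWulffConstant` of the venture `Summits/Ventures/Crystal3D`, second prover lane.  With the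
charged packages of this gen (`twinFree_pincers_charged`, `twinFree_dominant_bounds_charged`) and the
unconditional overlap constant `26.61` (`wulffPairOverlap_cap`), the dominant-class corner widens with
the wall charge (satellites `≤ (3/20)·Vol` at charge `1`, `≤ Vol/5` at `11/10`, `≤ (21/50)·Vol` at `3/2`:
`dominant_arith_gen`), and the certificate-free thresholds of `…RungTwinFreeTwoClassesCharged` (`6/5`)
and `…RungTwinFreeAllClassesCharged` (`2`) drop to `11/10` and `3/2`:

* `rung_dominant_charged_eleven_tenths` / `rung_dominant_charged_three_halves` : twin-free polyhedral
  crux textures with a lattice class of volume `≥ (4/5)·Vol` and generic charge `≥ 11/10`, resp.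
  `≥ (29/50)·Vol` and charge `≥ 3/2`, satisfy the bound (unconditionally);
* `rung_twinFree_twoClasses_eleven_tenths` : **≤ 2 lattice classes, generic charge `≥ 11/10` ⟹ the
  polycrystal Wulff bound, UNCONDITIONALLY** (dominant corner at `4/5`, else both classes `≥ Vol/5` and
  the intersection body `|W₁ ∩ W₂| ≥ 26.61` against the second pincer, `twoClass_arith_eleven_tenths`);
* `sum_rpow_two_thirds_ge_of_noDominant_29_50` : no class `≥ (29/50)·V` ⟹ `Σ v_ℓ^{2/3} ≥ 1.25·V^{2/3}`;
* `rung_twinFree_allClasses_three_halves` : **any number of lattice classes, generic charge `≥ 3/2` ⟹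
  the polycrystal Wulff bound, UNCONDITIONALLY** (dominant corner at `29/50`, else bulk at charge `3/2`,
  `bulk_pincer_arith_three_halves`).

LADDER of the all-generic (twin-free) class after this file (kernel, std axioms): necessary `≥ √5 − √3`
(paper) < V5 `13/25` < crux `1` (mod CH-P1′ + `AggCert27_8`; two-grain fact mod CH-P1) <
**`11/10` two lattices, certificate-free** < **`3/2` all lattices, certificate-free**.
WHAT THIS IS NOT: anything at the crux's own charge `1` without certificates; twins; the crux is not
claimed.
-/

noncomputable section

open scoped BigOperators InnerProductSpace ENNReal
open MeasureTheory Filter Finset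

namespace Summit.Ventures.Crystal3D.Cruxes.PolycrystalWulffBound.PolyDensity

open Summit.Ventures.Crystal3D.Theorems
open Summit.Ventures.Crystal3D.Cruxes.TextureLiminf.TexShadow (per polytope E3)
open Literature.MathematicalPhysics.StatisticalMechanics (perimeter)

/-! ### Charged dominant corners -/

/-- **Dominant class `≥ (4/5)·Vol`, generic charge `≥ 11/10`** ⟹ the polycrystal Wulff bound. -/
theorem rung_dominant_charged_eleven_tenths :
    let Λ : Set (EuclideanSpace ℝ (Fin 3)) := Literature.MathematicalPhysics.StatisticalMechanics.fccStacking 1 (Real.sqrt (2 / 3));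
    let Brl : (ℤ → ℤ) → Set (EuclideanSpace ℝ (Fin 3)) := Literature.MathematicalPhysics.StatisticalMechanics.barlowStacking 1 (Real.sqrt (2 / 3));
    let Ax : EuclideanSpace ℝ (Fin 3) → (EuclideanSpace ℝ (Fin 3) ≃ₗᵢ[ℝ] EuclideanSpace ℝ (Fin 3)) → (EuclideanSpace ℝ (Fin 3) ≃ₗᵢ[ℝ] EuclideanSpace ℝ (Fin 3)) → Prop := fun m A B => ∃ (L : EuclideanSpace ℝ (Fin 3) ≃ₗᵢ[ℝ] EuclideanSpace ℝ (Fin 3)) (s₁ s₂ : EuclideanSpace ℝ (Fin 3)) (σ σ' : ℤ → ℤ), Literature.MathematicalPhysics.StatisticalMechanics.IsHaggSeq σ ∧ Literature.MathematicalPhysics.StatisticalMechanics.IsHaggSeq σ' ∧ L (EuclideanSpace.single (2 : Fin 3) (1 : ℝ)) = m ∧ A '' Λ ⊆ (fun q => L q + s₁) '' Brl σ ∧ B '' Λ ⊆ (fun q => L q + s₂) '' Brl σ';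
    let CoAx : (EuclideanSpace ℝ (Fin 3) ≃ₗᵢ[ℝ] EuclideanSpace ℝ (Fin 3)) → (EuclideanSpace ℝ (Fin 3) ≃ₗᵢ[ℝ] EuclideanSpace ℝ (Fin 3)) → Prop := fun A B => ∃ m, Ax m A B;
    let Φ : EuclideanSpace ℝ (Fin 3) → ℝ := fun ν => Real.sqrt 2 / 4 * ∑ᶠ w ∈ {w ∈ Λ | ‖w‖ = 1}, |⟪w, ν⟫_ℝ|;
    let Per : Set (EuclideanSpace ℝ (Fin 3)) → Set (EuclideanSpace ℝ (Fin 3)) → ℝ := fun K S => (⨆ (ξ : EuclideanSpace ℝ (Fin 3) → EuclideanSpace ℝ (Fin 3)) (_ : ContDiff ℝ 1 ξ ∧ HasCompactSupport ξ ∧ ∀ z, ξ z ∈ K), ENNReal.ofReal (∫ z in S, Literature.MathematicalPhysics.StatisticalMechanics.fieldDivergence ξ z)).toReal;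
    let ι : Set (EuclideanSpace ℝ (Fin 3)) → Set (EuclideanSpace ℝ (Fin 3)) → Set (EuclideanSpace ℝ (Fin 3)) → ℝ := fun K S₁ S₂ => (Per K S₁ + Per K S₂ - Per K (S₁ ∪ S₂)) / 2;
    let W : (EuclideanSpace ℝ (Fin 3) ≃ₗᵢ[ℝ] EuclideanSpace ℝ (Fin 3)) → Set (EuclideanSpace ℝ (Fin 3)) := fun A => {y | ∀ ν : EuclideanSpace ℝ (Fin 3), ⟪y, ν⟫_ℝ ≤ Φ (A.symm ν)};
    let Dsc : EuclideanSpace ℝ (Fin 3) → Set (EuclideanSpace ℝ (Fin 3)) := fun m => {y | ‖y‖ ≤ 1 ∧ ⟪y, m⟫_ℝ = 0};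
    let Tex : (n : ℕ) → (Fin n → Set (EuclideanSpace ℝ (Fin 3))) → (Fin n → (EuclideanSpace ℝ (Fin 3) ≃ₗᵢ[ℝ] EuclideanSpace ℝ (Fin 3))) → (Fin n → Fin n → ℝ) → (Fin n → Fin n → EuclideanSpace ℝ (Fin 3)) → Prop := fun n G A c m => (∀ f : Fin n, Literature.MathematicalPhysics.StatisticalMechanics.HasFinitePerimeter (G f) ∧ volume (G f) < ⊤) ∧ (∀ f g, f ≠ g → Disjoint (G f) (G g)) ∧ (∀ f g, f ≠ g → 0 ≤ c f g) ∧ (∀ f g, f ≠ g → ¬ CoAx (A f) (A g) → m f g = 0 ∧ 1 ≤ c f g) ∧ (∀ f g, f ≠ g → CoAx (A f) (A g) → A f '' Λ ≠ A g '' Λ → Ax (m f g) (A f) (A g) ∧ 1 / 2 ≤ c f g);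
    let En : (n : ℕ) → (Fin n → Set (EuclideanSpace ℝ (Fin 3))) → (Fin n → (EuclideanSpace ℝ (Fin 3) ≃ₗᵢ[ℝ] EuclideanSpace ℝ (Fin 3))) → (Fin n → Fin n → ℝ) → (Fin n → Fin n → EuclideanSpace ℝ (Fin 3)) → ℝ := fun n G A c m => ∑ f : Fin n, Per (W (A f)) (G f) - ∑ f, ∑ g, (if f = g then 0 else ι (W (A f)) (G f) (G g)) + ∑ f, ∑ g, (if f = g then 0 else c f g / 2 * ι (Dsc (m f g)) (G f) (G g));
    let Vol : (n : ℕ) → (Fin n → Set (EuclideanSpace ℝ (Fin 3))) → ℝ := fun n G => (volume (⋃ f : Fin n, G f)).toReal;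
    let Poly : Set (EuclideanSpace ℝ (Fin 3)) → Prop := fun S => ∃ (k : ℕ) (H : Fin k → Finset ((EuclideanSpace ℝ (Fin 3)) × ℝ)), S = ⋃ i, ⋂ p ∈ H i, {x | ⟪p.1, x⟫_ℝ < p.2};
    let TF : (n : ℕ) → (Fin n → (EuclideanSpace ℝ (Fin 3) ≃ₗᵢ[ℝ] EuclideanSpace ℝ (Fin 3))) → Prop := fun n A => ∀ f g : Fin n, f ≠ g → CoAx (A f) (A g) → A f '' Λ = A g '' Λ;
    ∀ (n : ℕ) (G : Fin n → Set (EuclideanSpace ℝ (Fin 3))) (A : Fin n → (EuclideanSpace ℝ (Fin 3) ≃ₗᵢ[ℝ] EuclideanSpace ℝ (Fin 3))) (c : Fin n → Fin n → ℝ) (m : Fin n → Fin n → EuclideanSpace ℝ (Fin 3)), Tex n G A c m → (∀ f, Poly (G f)) → TF n A → (∀ f g : Fin n, f ≠ g → ¬ CoAx (A f) (A g) → (11 / 10 : ℝ) ≤ c f g) → (∃ f₀ : Fin n, 4 / 5 * Vol n G ≤ (volume (⋃ g ∈ {g : Fin n | A g '' Λ = A f₀ '' Λ}, G g)).toReal)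 → 6 * (2 : ℝ) ^ ((1 : ℝ) / 3) * (Real.sqrt 2 * Vol n G) ^ ((2 : ℝ) / 3) ≤ En n G A c m := by
  intro Λ Brl Ax CoAx Φ Per ι W Dsc Tex En Vol Poly TF n G A c m hTex hPoly hTF hCh hdom
  obtain ⟨f₀, hf₀⟩ := hdom
  obtain ⟨vD, s, Y, A₁, hvD0, hs0, hY0, hA0, hV, hvDeq, hiso, h1, h2⟩ :=
    twinFree_dominant_bounds_charged (11 / 10) n G A c m f₀ hTex hPoly hTF (by norm_num) hCh
  rw [← hvDeq] at hf₀
  have hVnn : 0 ≤ Vol n G := ENNReal.toReal_nonneg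
  have hV' : Vol n G = vD + s := hV
  have h1' : 6 * (2 : ℝ) ^ ((1 : ℝ) / 3) * (Real.sqrt 2 * Vol n G) ^ ((2 : ℝ) / 3) -
      (Real.sqrt 5 - Real.sqrt 3) * Y + (11 / 10) * A₁ ≤ En n G A c m := h1
  have h2' : 6 * (2 : ℝ) ^ ((1 : ℝ) / 3) * (Real.sqrt 2 * vD) ^ ((2 : ℝ) / 3) +
      Real.sqrt 3 * Y - (Real.sqrt 5 - 11 / 10) * A₁ ≤ En n G A c m := h2
  have hs : s ≤ 1 / 5 * Vol n G := by rw [hV'] at hf₀ ⊢; linarith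
  have ha : (0.8617 : ℝ) ≤ (1 - 1 / 5 : ℝ) ^ ((2 : ℝ) / 3) := by
    rw [show (1 - 1 / 5 : ℝ) = 4 / 5 by norm_num]; exact rpow_four_fifths_lower
  have hκs : Vol n G ^ ((2 : ℝ) / 3) ≤ vD ^ ((2 : ℝ) / 3) + 0.406 * s ^ ((2 : ℝ) / 3) := by
    have h := rpow_two_thirds_dominant_gen (σ := 1 / 5) (κ := 0.406) (by norm_num) (by norm_num)
      (by norm_num) ha rpow_one_fifth_lower (by norm_num) hVnn hs0 hs
    rwa [show Vol n G - s = vD by rw [hV']; ring] at h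
  have h3 := sqrt_three_lower
  have h5 := sqrt_five_upper
  have h5l := sqrt_five_lower'
  exact dominant_arith_gen (u := 0.36) (μ := 0.295) isoConst_three_pos
    (le_of_eq isoConst_three_cube.symm) hvD0 hs0 hV' (by norm_num) hκs hY0 hA0 hiso h1' h2'
    (by norm_num) (by norm_num) (by norm_num) (by nlinarith) (by nlinarith) (by norm_num)

/-- **Dominant class `≥ (29/50)·Vol`, generic charge `≥ 3/2`** ⟹ the polycrystal Wulff bound. -/
theorem rung_dominant_charged_three_halves :
    let Λ : Set (EuclideanSpace ℝ (Fin 3)) := Literature.MathematicalPhysics.StatisticalMechanics.fccStacking 1 (Real.sqrt (2 / 3));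
    let Brl : (ℤ → ℤ) → Set (EuclideanSpace ℝ (Fin 3)) := Literature.MathematicalPhysics.StatisticalMechanics.barlowStacking 1 (Real.sqrt (2 / 3));
    let Ax : EuclideanSpace ℝ (Fin 3) → (EuclideanSpace ℝ (Fin 3) ≃ₗᵢ[ℝ] EuclideanSpace ℝ (Fin 3)) → (EuclideanSpace ℝ (Fin 3) ≃ₗᵢ[ℝ] EuclideanSpace ℝ (Fin 3)) → Prop := fun m A B => ∃ (L : EuclideanSpace ℝ (Fin 3) ≃ₗᵢ[ℝ] EuclideanSpace ℝ (Fin 3)) (s₁ s₂ : EuclideanSpace ℝ (Fin 3)) (σ σ' : ℤ → ℤ), Literature.MathematicalPhysics.StatisticalMechanics.IsHaggSeq σ ∧ Literature.MathematicalPhysics.StatisticalMechanics.IsHaggSeq σ' ∧ L (EuclideanSpace.single (2 : Fin 3) (1 : ℝ)) = m ∧ A '' Λ ⊆ (fun q => L q + s₁) '' Brl σ ∧ B '' Λ ⊆ (fun q => L q + s₂) '' Brl σ';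
    let CoAx : (EuclideanSpace ℝ (Fin 3) ≃ₗᵢ[ℝ] EuclideanSpace ℝ (Fin 3)) → (EuclideanSpace ℝ (Fin 3) ≃ₗᵢ[ℝ] EuclideanSpace ℝ (Fin 3)) → Prop := fun A B => ∃ m, Ax m A B;
    let Φ : EuclideanSpace ℝ (Fin 3) → ℝ := fun ν => Real.sqrt 2 / 4 * ∑ᶠ w ∈ {w ∈ Λ | ‖w‖ = 1}, |⟪w, ν⟫_ℝ|;
    let Per : Set (EuclideanSpace ℝ (Fin 3)) → Set (EuclideanSpace ℝ (Fin 3)) → ℝ := fun K S => (⨆ (ξ : EuclideanSpace ℝ (Fin 3) → EuclideanSpace ℝ (Fin 3)) (_ : ContDiff ℝ 1 ξ ∧ HasCompactSupport ξ ∧ ∀ z, ξ z ∈ K), ENNReal.ofReal (∫ z in S, Literature.MathematicalPhysics.StatisticalMechanics.fieldDivergence ξ z)).toReal;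
    let ι : Set (EuclideanSpace ℝ (Fin 3)) → Set (EuclideanSpace ℝ (Fin 3)) → Set (EuclideanSpace ℝ (Fin 3)) → ℝ := fun K S₁ S₂ => (Per K S₁ + Per K S₂ - Per K (S₁ ∪ S₂)) / 2;
    let W : (EuclideanSpace ℝ (Fin 3) ≃ₗᵢ[ℝ] EuclideanSpace ℝ (Fin 3)) → Set (EuclideanSpace ℝ (Fin 3)) := fun A => {y | ∀ ν : EuclideanSpace ℝ (Fin 3), ⟪y, ν⟫_ℝ ≤ Φ (A.symm ν)};
    let Dsc : EuclideanSpace ℝ (Fin 3) → Set (EuclideanSpace ℝ (Fin 3)) := fun m => {y | ‖y‖ ≤ 1 ∧ ⟪y, m⟫_ℝ = 0};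
    let Tex : (n : ℕ) → (Fin n → Set (EuclideanSpace ℝ (Fin 3))) → (Fin n → (EuclideanSpace ℝ (Fin 3) ≃ₗᵢ[ℝ] EuclideanSpace ℝ (Fin 3))) → (Fin n → Fin n → ℝ) → (Fin n → Fin n → EuclideanSpace ℝ (Fin 3)) → Prop := fun n G A c m => (∀ f : Fin n, Literature.MathematicalPhysics.StatisticalMechanics.HasFinitePerimeter (G f) ∧ volume (G f) < ⊤) ∧ (∀ f g, f ≠ g → Disjoint (G f) (G g)) ∧ (∀ f g, f ≠ g → 0 ≤ c f g) ∧ (∀ f g, f ≠ g → ¬ CoAx (A f) (A g) → m f g = 0 ∧ 1 ≤ c f g) ∧ (∀ f g, f ≠ g → CoAx (A f) (A g) → A f '' Λ ≠ A g '' Λ → Ax (m f g) (A f) (A g) ∧ 1 / 2 ≤ c f g);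
    let En : (n : ℕ) → (Fin n → Set (EuclideanSpace ℝ (Fin 3))) → (Fin n → (EuclideanSpace ℝ (Fin 3) ≃ₗᵢ[ℝ] EuclideanSpace ℝ (Fin 3))) → (Fin n → Fin n → ℝ) → (Fin n → Fin n → EuclideanSpace ℝ (Fin 3)) → ℝ := fun n G A c m => ∑ f : Fin n, Per (W (A f)) (G f) - ∑ f, ∑ g, (if f = g then 0 else ι (W (A f)) (G f) (G g)) + ∑ f, ∑ g, (if f = g then 0 else c f g / 2 * ι (Dsc (m f g)) (G f) (G g));
    let Vol : (n : ℕ) → (Fin n → Set (EuclideanSpace ℝ (Fin 3))) → ℝ := fun n G => (volume (⋃ f : Fin n, G f)).toReal;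
    let Poly : Set (EuclideanSpace ℝ (Fin 3)) → Prop := fun S => ∃ (k : ℕ) (H : Fin k → Finset ((EuclideanSpace ℝ (Fin 3)) × ℝ)), S = ⋃ i, ⋂ p ∈ H i, {x | ⟪p.1, x⟫_ℝ < p.2};
    let TF : (n : ℕ) → (Fin n → (EuclideanSpace ℝ (Fin 3) ≃ₗᵢ[ℝ] EuclideanSpace ℝ (Fin 3))) → Prop := fun n A => ∀ f g : Fin n, f ≠ g → CoAx (A f) (A g) → A f '' Λ = A g '' Λ;
    ∀ (n : ℕ) (G : Fin n → Set (EuclideanSpace ℝ (Fin 3))) (A : Fin n → (EuclideanSpace ℝ (Fin 3) ≃ₗᵢ[ℝ] EuclideanSpace ℝ (Fin 3))) (c : Fin n → Fin n → ℝ) (m : Fin n → Fin n → EuclideanSpace ℝ (Fin 3)), Tex n G A c m → (∀ f, Poly (G f)) → TF n A → (∀ f g : Fin n, f ≠ g → ¬ CoAx (A f) (A g) → (3 / 2 : ℝ) ≤ c f g) → (∃ f₀ : Fin n, 29 / 50 * Vol n G ≤ (volume (⋃ g ∈ {g : Fin n | A g '' Λ = A f₀ '' Λ}, G g)).toReal)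 → 6 * (2 : ℝ) ^ ((1 : ℝ) / 3) * (Real.sqrt 2 * Vol n G) ^ ((2 : ℝ) / 3) ≤ En n G A c m := by
  intro Λ Brl Ax CoAx Φ Per ι W Dsc Tex En Vol Poly TF n G A c m hTex hPoly hTF hCh hdom
  obtain ⟨f₀, hf₀⟩ := hdom
  obtain ⟨vD, s, Y, A₁, hvD0, hs0, hY0, hA0, hV, hvDeq, hiso, h1, h2⟩ :=
    twinFree_dominant_bounds_charged (3 / 2) n G A c m f₀ hTex hPoly hTF (by norm_num) hCh
  rw [← hvDeq] at hf₀
  have hVnn : 0 ≤ Vol n G := ENNReal.toReal_nonneg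
  have hV' : Vol n G = vD + s := hV
  have h1' : 6 * (2 : ℝ) ^ ((1 : ℝ) / 3) * (Real.sqrt 2 * Vol n G) ^ ((2 : ℝ) / 3) -
      (Real.sqrt 5 - Real.sqrt 3) * Y + (3 / 2) * A₁ ≤ En n G A c m := h1
  have h2' : 6 * (2 : ℝ) ^ ((1 : ℝ) / 3) * (Real.sqrt 2 * vD) ^ ((2 : ℝ) / 3) +
      Real.sqrt 3 * Y - (Real.sqrt 5 - 3 / 2) * A₁ ≤ En n G A c m := h2
  have hs : s ≤ 21 / 50 * Vol n G := by rw [hV'] at hf₀ ⊢; linarith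
  have ha : (0.6954 : ℝ) ≤ (1 - 21 / 50 : ℝ) ^ ((2 : ℝ) / 3) := by
    rw [show (1 - 21 / 50 : ℝ) = 29 / 50 by norm_num]; exact rpow_29_50_lower
  have hκs : Vol n G ^ ((2 : ℝ) / 3) ≤ vD ^ ((2 : ℝ) / 3) + 0.545 * s ^ ((2 : ℝ) / 3) := by
    have h := rpow_two_thirds_dominant_gen (σ := 21 / 50) (κ := 0.545) (by norm_num) (by norm_num)
      (by norm_num) ha rpow_21_50_lower (by norm_num) hVnn hs0 hs
    rwa [show Vol n G - s = vD by rw [hV']; ring] at h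
  have h3 := sqrt_three_lower
  have h5 := sqrt_five_upper
  have h5l := sqrt_five_lower'
  exact dominant_arith_gen (u := 0.448) (μ := 0.497) isoConst_three_pos
    (le_of_eq isoConst_three_cube.symm) hvD0 hs0 hV' (by norm_num) hκs hY0 hA0 hiso h1' h2'
    (by norm_num) (by norm_num) (by norm_num) (by nlinarith) (by nlinarith) (by norm_num)

/-! ### Two lattice classes at charge `11/10` -/

/-- **Twin-free polyhedral crux textures with at most two lattice classes and generic walls charged
`≥ 11/10` satisfy the polycrystal Wulff bound — unconditionally.** -/
theorem rung_twinFree_twoClasses_eleven_tenths :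
    let Λ : Set (EuclideanSpace ℝ (Fin 3)) := Literature.MathematicalPhysics.StatisticalMechanics.fccStacking 1 (Real.sqrt (2 / 3));
    let Brl : (ℤ → ℤ) → Set (EuclideanSpace ℝ (Fin 3)) := Literature.MathematicalPhysics.StatisticalMechanics.barlowStacking 1 (Real.sqrt (2 / 3));
    let Ax : EuclideanSpace ℝ (Fin 3) → (EuclideanSpace ℝ (Fin 3) ≃ₗᵢ[ℝ] EuclideanSpace ℝ (Fin 3)) → (EuclideanSpace ℝ (Fin 3) ≃ₗᵢ[ℝ] EuclideanSpace ℝ (Fin 3)) → Prop := fun m A B => ∃ (L : EuclideanSpace ℝ (Fin 3) ≃ₗᵢ[ℝ] EuclideanSpace ℝ (Fin 3)) (s₁ s₂ : EuclideanSpace ℝ (Fin 3)) (σ σ' : ℤ → ℤ), Literature.MathematicalPhysics.StatisticalMechanics.IsHaggSeq σ ∧ Literature.MathematicalPhysics.StatisticalMechanics.IsHaggSeq σ' ∧ L (EuclideanSpace.single (2 : Fin 3) (1 : ℝ)) = m ∧ A '' Λ ⊆ (fun q => L q + s₁) '' Brl σ ∧ B '' Λ ⊆ (fun q => L q + s₂)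 '' Brl σ';
    let CoAx : (EuclideanSpace ℝ (Fin 3) ≃ₗᵢ[ℝ] EuclideanSpace ℝ (Fin 3)) → (EuclideanSpace ℝ (Fin 3) ≃ₗᵢ[ℝ] EuclideanSpace ℝ (Fin 3)) → Prop := fun A B => ∃ m, Ax m A B;
    let Φ : EuclideanSpace ℝ (Fin 3) → ℝ := fun ν => Real.sqrt 2 / 4 * ∑ᶠ w ∈ {w ∈ Λ | ‖w‖ = 1}, |⟪w, ν⟫_ℝ|;
    let Per : Set (EuclideanSpace ℝ (Fin 3)) → Set (EuclideanSpace ℝ (Fin 3)) → ℝ := fun K S => (⨆ (ξ : EuclideanSpace ℝ (Fin 3) → EuclideanSpace ℝ (Fin 3)) (_ : ContDiff ℝ 1 ξ ∧ HasCompactSupport ξ ∧ ∀ z, ξ z ∈ K), ENNReal.ofReal (∫ z in S, Literature.MathematicalPhysics.StatisticalMechanics.fieldDivergence ξ z)).toReal;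
    let ι : Set (EuclideanSpace ℝ (Fin 3)) → Set (EuclideanSpace ℝ (Fin 3)) → Set (EuclideanSpace ℝ (Fin 3)) → ℝ := fun K S₁ S₂ => (Per K S₁ + Per K S₂ - Per K (S₁ ∪ S₂)) / 2;
    let W : (EuclideanSpace ℝ (Fin 3) ≃ₗᵢ[ℝ] EuclideanSpace ℝ (Fin 3)) → Set (EuclideanSpace ℝ (Fin 3)) := fun A => {y | ∀ ν : EuclideanSpace ℝ (Fin 3), ⟪y, ν⟫_ℝ ≤ Φ (A.symm ν)};
    let Dsc : EuclideanSpace ℝ (Fin 3) → Set (EuclideanSpace ℝ (Fin 3)) := fun m => {y | ‖y‖ ≤ 1 ∧ ⟪y, m⟫_ℝ = 0};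
    let Tex : (n : ℕ) → (Fin n → Set (EuclideanSpace ℝ (Fin 3))) → (Fin n → (EuclideanSpace ℝ (Fin 3) ≃ₗᵢ[ℝ] EuclideanSpace ℝ (Fin 3))) → (Fin n → Fin n → ℝ) → (Fin n → Fin n → EuclideanSpace ℝ (Fin 3)) → Prop := fun n G A c m => (∀ f : Fin n, Literature.MathematicalPhysics.StatisticalMechanics.HasFinitePerimeter (G f) ∧ volume (G f) < ⊤) ∧ (∀ f g, f ≠ g → Disjoint (G f) (G g)) ∧ (∀ f g, f ≠ g → 0 ≤ c f g) ∧ (∀ f g, f ≠ g → ¬ CoAx (A f) (A g) → m f g = 0 ∧ 1 ≤ c f g) ∧ (∀ f g, f ≠ g → CoAx (A f) (A g) → A f '' Λ ≠ A g '' Λ → Ax (m f g) (A f) (A g) ∧ 1 / 2 ≤ c f g);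
    let En : (n : ℕ) → (Fin n → Set (EuclideanSpace ℝ (Fin 3))) → (Fin n → (EuclideanSpace ℝ (Fin 3) ≃ₗᵢ[ℝ] EuclideanSpace ℝ (Fin 3))) → (Fin n → Fin n → ℝ) → (Fin n → Fin n → EuclideanSpace ℝ (Fin 3)) → ℝ := fun n G A c m => ∑ f : Fin n, Per (W (A f)) (G f) - ∑ f, ∑ g, (if f = g then 0 else ι (W (A f)) (G f) (G g)) + ∑ f, ∑ g, (if f = g then 0 else c f g / 2 * ι (Dsc (m f g)) (G f) (G g));
    let Vol : (n : ℕ) → (Fin n → Set (EuclideanSpace ℝ (Fin 3))) → ℝ := fun n G => (volume (⋃ f : Fin n, G f)).toReal;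
    let Poly : Set (EuclideanSpace ℝ (Fin 3)) → Prop := fun S => ∃ (k : ℕ) (H : Fin k → Finset ((EuclideanSpace ℝ (Fin 3)) × ℝ)), S = ⋃ i, ⋂ p ∈ H i, {x | ⟪p.1, x⟫_ℝ < p.2};
    let TF : (n : ℕ) → (Fin n → (EuclideanSpace ℝ (Fin 3) ≃ₗᵢ[ℝ] EuclideanSpace ℝ (Fin 3))) → Prop := fun n A => ∀ f g : Fin n, f ≠ g → CoAx (A f) (A g) → A f '' Λ = A g '' Λ;
    ∀ (n : ℕ) (G : Fin n → Set (EuclideanSpace ℝ (Fin 3))) (A : Fin n → (EuclideanSpace ℝ (Fin 3) ≃ₗᵢ[ℝ] EuclideanSpace ℝ (Fin 3))) (c : Fin n → Fin n → ℝ) (m : Fin n → Fin n → EuclideanSpace ℝ (Fin 3)), Tex n G A c m → (∀ f, Poly (G f)) → TF n A → (∀ f g h : Fin n, A f '' Λ = A g '' Λ ∨ A g '' Λ = A h '' Λ ∨ A f '' Λ = A h '' Λ) → (∀ f g : Fin n, f ≠ g → ¬ CoAx (A f) (A g) → (11 / 10 : ℝ) ≤ c f g) → 6 * (2 : ℝ)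 ^ ((1 : ℝ) / 3) * (Real.sqrt 2 * Vol n G) ^ ((2 : ℝ) / 3) ≤ En n G A c m := by
  intro Λ Brl Ax CoAx Φ Per ι W Dsc Tex En Vol Poly TF n G A c m hTex hPoly hTF hTwo hCh
  by_cases hdom : ∃ f₀ : Fin n, 4 / 5 * Vol n G ≤ (volume (⋃ g ∈ {g : Fin n | A g '' Λ = A f₀ '' Λ}, G g)).toReal
  · exact rung_dominant_charged_eleven_tenths n G A c m hTex hPoly hTF hCh hdom
  classical
  obtain ⟨D, hD0, hP1, hP2, hP3, hV⟩ := twinFree_pincers_charged (11 / 10) n G A c m hTex hPoly hTF hCh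
  -- lattice classes and their volumes
  set lat : Fin n → Set E3 := fun f => A f '' Λ with hlat
  set L : Finset (Set E3) := Finset.univ.image lat with hL
  set v : Set E3 → ℝ := fun ℓ =>
    (volume (⋃ f ∈ Finset.univ.filter (fun f => lat f = ℓ), G f)).toReal with hv
  have hset : ∀ f₀, (⋃ f ∈ Finset.univ.filter (fun f => lat f = lat f₀), G f) =
      ⋃ g ∈ {g : Fin n | A g '' Λ = A f₀ '' Λ}, G g := by
    intro f₀
    ext x
    simp only [Set.mem_iUnion, Finset.mem_filter, Finset.mem_univ, true_and, Set.mem_setOf_eq,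
      exists_prop, hlat]
  have hlt : ∀ f₀, v (lat f₀) < 4 / 5 * Vol n G := by
    intro f₀
    by_contra h
    exact hdom ⟨f₀, by rw [← hset f₀]; exact not_lt.1 h⟩
  have hVnn : 0 ≤ Vol n G := ENNReal.toReal_nonneg
  have hV' : Vol n G = ∑ ℓ ∈ L, v ℓ := hV
  -- no grains: trivial
  rcases isEmpty_or_nonempty (Fin n) with hn | ⟨⟨f₁⟩⟩
  · -- no grains: `Vol = 0` and the energy is `≥ 0` by the first pincer
    have hL0 : L = ∅ := by
      rw [hL]; exact Finset.image_eq_empty.2 (Finset.univ_eq_empty_iff.2 hn)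
    have hV0 : Vol n G = 0 := by rw [hV', hL0, Finset.sum_empty]
    have hP1' : Real.sqrt 3 * (perimeter (⋃ f, G f)).toReal + 11 / 10 / 2 * D ≤ En n G A c m := hP1
    have hP0 : 0 ≤ (perimeter (⋃ f, G f)).toReal := ENNReal.toReal_nonneg
    have h3 : 0 ≤ Real.sqrt 3 := Real.sqrt_nonneg 3
    rw [hV0, mul_zero, Real.zero_rpow (by norm_num), mul_zero]
    nlinarith [mul_nonneg h3 hP0]
  -- a second class exists
  obtain ⟨f₂, hne⟩ : ∃ f₂, lat f₂ ≠ lat f₁ := by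
    by_contra hall
    push Not at hall
    have hL1 : L = {lat f₁} := by
      ext ℓ
      simp only [hL, Finset.mem_image, Finset.mem_univ, true_and, Finset.mem_singleton]
      exact ⟨fun ⟨f, hf⟩ => hf ▸ hall f, fun h => ⟨f₁, h.symm⟩⟩
    have hV1 : Vol n G = v (lat f₁) := by rw [hV', hL1, Finset.sum_singleton]
    have := hlt f₁
    rw [← hV1] at this
    linarith
  have hL2 : L = {lat f₁, lat f₂} := by
    ext ℓ
    simp only [hL, Finset.mem_image, Finset.mem_univ, true_and, Finset.mem_insert,
      Finset.mem_singleton]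
    constructor
    · rintro ⟨f, rfl⟩
      rcases hTwo f f₁ f₂ with h | h | h
      · exact Or.inl h
      · exact absurd h.symm hne
      · exact Or.inr h
    · rintro (h | h)
      · exact ⟨f₁, h.symm⟩
      · exact ⟨f₂, h.symm⟩
  have hne' : lat f₁ ≠ lat f₂ := fun h => hne h.symm
  have hV2 : Vol n G = v (lat f₁) + v (lat f₂) := by rw [hV', hL2, Finset.sum_pair hne']
  have hb1 : 1 / 5 * Vol n G ≤ v (lat f₁) := by have := hlt f₂; linarith
  have hb2 : 1 / 5 * Vol n G ≤ v (lat f₂) := by have := hlt f₁; linarith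
  -- the intersection body of the two classes
  have hWc : ∀ f, IsCompact (W (A f)) := fun f => isCompact_cruxWulffBody (A f)
  have hWv : ∀ f, Convex ℝ (W (A f)) := fun f => convex_cruxWulffBody (A f)
  have hW0 : ∀ f, (0 : E3) ∈ W (A f) := fun f => zero_mem_cruxWulffBody (A f)
  have hWs : ∀ f, -W (A f) = W (A f) := fun f => neg_cruxWulffBody_eq (A f)
  have hWeq : ∀ f g, lat f = lat g → W (A f) = W (A g) := fun f g h => wulffBody_eq_of_image_eq h
  set K : Set E3 := W (A f₁) ∩ W (A f₂) with hK
  have hKsub : ∀ f, K ⊆ W (A f) := by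
    intro f
    rcases hTwo f f₁ f₂ with h | h | h
    · rw [hWeq f f₁ h]; exact Set.inter_subset_left
    · exact absurd h.symm hne
    · rw [hWeq f f₂ h]; exact Set.inter_subset_right
  have hKvol : (26.61 : ℝ) ≤ (volume K).toReal := volume_cruxWulffBody_inter_ge_cap (A f₁) (A f₂)
  have hInter : 3 * (volume K).toReal ^ ((1 : ℝ) / 3) * (Vol n G) ^ ((2 : ℝ) / 3) + 11 / 10 / 2 * D ≤
      En n G A c m :=
    hP3 K ((hWc f₁).inter (hWc f₂)) ((hWv f₁).inter (hWv f₂)) ⟨hW0 f₁, hW0 f₂⟩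
      (by rw [hK, Set.inter_neg, hWs f₁, hWs f₂]) hKsub
  -- the two bounds and the arithmetic
  have hK' : 3 * (volume K).toReal ^ ((1 : ℝ) / 3) * (Vol n G) ^ ((2 : ℝ) / 3) + 11 / 20 * D ≤
      En n G A c m := by
    linarith
  have hP2' : (∑ ℓ ∈ L, 6 * (2 : ℝ) ^ ((1 : ℝ) / 3) * (Real.sqrt 2 * v ℓ) ^ ((2 : ℝ) / 3)) -
      (Real.sqrt 5 - 11 / 10 / 2) * D ≤ En n G A c m := hP2
  have hP' : 6 * (2 : ℝ) ^ ((1 : ℝ) / 3) * (Real.sqrt 2 * v (lat f₁)) ^ ((2 : ℝ) / 3) +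
      6 * (2 : ℝ) ^ ((1 : ℝ) / 3) * (Real.sqrt 2 * v (lat f₂)) ^ ((2 : ℝ) / 3) -
      (Real.sqrt 5 - 11 / 20) * D ≤ En n G A c m := by
    rw [hL2, Finset.sum_pair hne'] at hP2'
    linarith
  exact twoClass_arith_eleven_tenths hV2 hb1 hb2 hKvol hD0 hK' hP'

/-! ### All lattice classes at charge `3/2` -/

/-- **No class `≥ (29/50)·V` ⟹ bulk at `1.25`.**  For class volumes `v ℓ ≥ 0` with `V = Σ v ℓ` and
every `v ℓ < (29/50)·V`: `1.25·V^{2/3} ≤ Σ (v ℓ)^{2/3}`. -/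
theorem sum_rpow_two_thirds_ge_of_noDominant_29_50 {κ : Type*} (s : Finset κ) {v : κ → ℝ} {V : ℝ}
    (hV : V = ∑ i ∈ s, v i) (hv : ∀ i ∈ s, 0 ≤ v i) (hnd : ∀ i ∈ s, v i < 29 / 50 * V) :
    (1.25 : ℝ) * V ^ ((2 : ℝ) / 3) ≤ ∑ i ∈ s, v i ^ ((2 : ℝ) / 3) := by
  classical
  have hV0 : 0 ≤ V := by rw [hV]; exact sum_nonneg hv
  rcases s.eq_empty_or_nonempty with hs | hne
  · subst hs
    simp only [sum_empty] at hV ⊢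
    rw [hV, Real.zero_rpow (by norm_num), mul_zero]
  obtain ⟨ℓ₁, hℓ₁, hmax⟩ := exists_max_image s v hne
  have hW0 : 0 ≤ V ^ ((2 : ℝ) / 3) := by positivity
  by_cases hhalf : v ℓ₁ ≤ 1 / 2 * V
  · have hsmall : ∀ i ∈ s, v i ≤ 1 / 2 * V := fun i hi => (hmax i hi).trans hhalf
    have h := sum_rpow_two_thirds_ge s (by norm_num : (0 : ℝ) < 1 / 2) hV hv hsmall
    have h2 := rpow_half_neg_third_ge
    nlinarith [mul_le_mul_of_nonneg_right h2 hW0]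
  · rw [not_le] at hhalf
    set R : ℝ := ∑ i ∈ s.erase ℓ₁, v i with hR
    have hsplit : V = v ℓ₁ + R := by rw [hV, hR, ← add_sum_erase s v hℓ₁]
    have hvR : ∀ i ∈ s.erase ℓ₁, 0 ≤ v i := fun i hi => hv i (mem_of_mem_erase hi)
    have hrest : (1 : ℝ) ^ (-(1 : ℝ) / 3) * R ^ ((2 : ℝ) / 3) ≤ ∑ i ∈ s.erase ℓ₁, v i ^ ((2 : ℝ) / 3) :=
      sum_rpow_two_thirds_ge (s.erase ℓ₁) one_pos rfl hvR
        (fun i hi => by rw [one_mul]; exact single_le_sum hvR hi)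
    rw [Real.one_rpow, one_mul] at hrest
    have h1 : 21 / 50 * V ≤ v ℓ₁ := by linarith
    have h2 : 21 / 50 * V ≤ R := by have := hnd ℓ₁ hℓ₁; linarith
    have hkey := rpow_two_thirds_two_classes_gen (σ := 21 / 50) (by norm_num) (by norm_num) hsplit h1 h2
    rw [show (1 - 21 / 50 : ℝ) = 29 / 50 by norm_num] at hkey
    have ha := rpow_29_50_lower
    have hb := rpow_21_50_lower
    rw [← add_sum_erase s (fun i => v i ^ ((2 : ℝ) / 3)) hℓ₁]
    have hsum : (1.2562 : ℝ) * V ^ ((2 : ℝ) / 3) ≤ v ℓ₁ ^ ((2 : ℝ) / 3) + R ^ ((2 : ℝ) / 3) := by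
      nlinarith [hkey, ha, hb, hW0]
    linarith

/-- **Every twin-free polyhedral crux texture whose generic walls carry charge `≥ 3/2` satisfies the
polycrystal Wulff bound — unconditionally, for any number of lattice classes.** -/
theorem rung_twinFree_allClasses_three_halves :
    let Λ : Set (EuclideanSpace ℝ (Fin 3)) := Literature.MathematicalPhysics.StatisticalMechanics.fccStacking 1 (Real.sqrt (2 / 3));
    let Brl : (ℤ → ℤ) → Set (EuclideanSpace ℝ (Fin 3)) := Literature.MathematicalPhysics.StatisticalMechanics.barlowStacking 1 (Real.sqrt (2 / 3));
    let Ax : EuclideanSpace ℝ (Fin 3) → (EuclideanSpace ℝ (Fin 3) ≃ₗᵢ[ℝ] EuclideanSpace ℝ (Fin 3)) → (EuclideanSpace ℝ (Fin 3) ≃ₗᵢ[ℝ] EuclideanSpace ℝ (Fin 3)) → Prop := fun m A B => ∃ (L : EuclideanSpace ℝ (Fin 3) ≃ₗᵢ[ℝ] EuclideanSpace ℝ (Fin 3)) (s₁ s₂ : EuclideanSpace ℝ (Fin 3)) (σ σ' : ℤ → ℤ), Literature.MathematicalPhysics.StatisticalMechanics.IsHaggSeq σ ∧ Literature.MathematicalPhysics.StatisticalMechanics.IsHaggSeq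 σ' ∧ L (EuclideanSpace.single (2 : Fin 3) (1 : ℝ)) = m ∧ A '' Λ ⊆ (fun q => L q + s₁) '' Brl σ ∧ B '' Λ ⊆ (fun q => L q + s₂) '' Brl σ';
    let CoAx : (EuclideanSpace ℝ (Fin 3) ≃ₗᵢ[ℝ] EuclideanSpace ℝ (Fin 3)) → (EuclideanSpace ℝ (Fin 3) ≃ₗᵢ[ℝ] EuclideanSpace ℝ (Fin 3)) → Prop := fun A B => ∃ m, Ax m A B;
    let Φ : EuclideanSpace ℝ (Fin 3) → ℝ := fun ν => Real.sqrt 2 / 4 * ∑ᶠ w ∈ {w ∈ Λ | ‖w‖ = 1}, |⟪w, ν⟫_ℝ|;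
    let Per : Set (EuclideanSpace ℝ (Fin 3)) → Set (EuclideanSpace ℝ (Fin 3)) → ℝ := fun K S => (⨆ (ξ : EuclideanSpace ℝ (Fin 3) → EuclideanSpace ℝ (Fin 3)) (_ : ContDiff ℝ 1 ξ ∧ HasCompactSupport ξ ∧ ∀ z, ξ z ∈ K), ENNReal.ofReal (∫ z in S, Literature.MathematicalPhysics.StatisticalMechanics.fieldDivergence ξ z)).toReal;
    let ι : Set (EuclideanSpace ℝ (Fin 3)) → Set (EuclideanSpace ℝ (Fin 3)) → Set (EuclideanSpace ℝ (Fin 3)) → ℝ := fun K S₁ S₂ => (Per K S₁ + Per K S₂ - Per K (S₁ ∪ S₂)) / 2;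
    let W : (EuclideanSpace ℝ (Fin 3) ≃ₗᵢ[ℝ] EuclideanSpace ℝ (Fin 3)) → Set (EuclideanSpace ℝ (Fin 3)) := fun A => {y | ∀ ν : EuclideanSpace ℝ (Fin 3), ⟪y, ν⟫_ℝ ≤ Φ (A.symm ν)};
    let Dsc : EuclideanSpace ℝ (Fin 3) → Set (EuclideanSpace ℝ (Fin 3)) := fun m => {y | ‖y‖ ≤ 1 ∧ ⟪y, m⟫_ℝ = 0};
    let Tex : (n : ℕ) → (Fin n → Set (EuclideanSpace ℝ (Fin 3))) → (Fin n → (EuclideanSpace ℝ (Fin 3) ≃ₗᵢ[ℝ] EuclideanSpace ℝ (Fin 3))) → (Fin n → Fin n → ℝ) → (Fin n → Fin n → EuclideanSpace ℝ (Fin 3)) → Prop := fun n G A c m => (∀ f : Fin n, Literature.MathematicalPhysics.StatisticalMechanics.HasFinitePerimeter (G f) ∧ volume (G f) < ⊤) ∧ (∀ f g, f ≠ g → Disjoint (G f) (G g)) ∧ (∀ f g, f ≠ g → 0 ≤ c f g) ∧ (∀ f g, f ≠ g → ¬ CoAx (A f) (A g) → m f g = 0 ∧ 1 ≤ c f g)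 ∧ (∀ f g, f ≠ g → CoAx (A f) (A g) → A f '' Λ ≠ A g '' Λ → Ax (m f g) (A f) (A g) ∧ 1 / 2 ≤ c f g);
    let En : (n : ℕ) → (Fin n → Set (EuclideanSpace ℝ (Fin 3))) → (Fin n → (EuclideanSpace ℝ (Fin 3) ≃ₗᵢ[ℝ] EuclideanSpace ℝ (Fin 3))) → (Fin n → Fin n → ℝ) → (Fin n → Fin n → EuclideanSpace ℝ (Fin 3)) → ℝ := fun n G A c m => ∑ f : Fin n, Per (W (A f)) (G f) - ∑ f, ∑ g, (if f = g then 0 else ι (W (A f)) (G f) (G g)) + ∑ f, ∑ g, (if f = g then 0 else c f g / 2 * ι (Dsc (m f g)) (G f) (G g));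
    let Vol : (n : ℕ) → (Fin n → Set (EuclideanSpace ℝ (Fin 3))) → ℝ := fun n G => (volume (⋃ f : Fin n, G f)).toReal;
    let Poly : Set (EuclideanSpace ℝ (Fin 3)) → Prop := fun S => ∃ (k : ℕ) (H : Fin k → Finset ((EuclideanSpace ℝ (Fin 3)) × ℝ)), S = ⋃ i, ⋂ p ∈ H i, {x | ⟪p.1, x⟫_ℝ < p.2};
    let TF : (n : ℕ) → (Fin n → (EuclideanSpace ℝ (Fin 3) ≃ₗᵢ[ℝ] EuclideanSpace ℝ (Fin 3))) → Prop := fun n A => ∀ f g : Fin n, f ≠ g → CoAx (A f) (A g) → A f '' Λ = A g '' Λ;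
    ∀ (n : ℕ) (G : Fin n → Set (EuclideanSpace ℝ (Fin 3))) (A : Fin n → (EuclideanSpace ℝ (Fin 3) ≃ₗᵢ[ℝ] EuclideanSpace ℝ (Fin 3))) (c : Fin n → Fin n → ℝ) (m : Fin n → Fin n → EuclideanSpace ℝ (Fin 3)), Tex n G A c m → (∀ f, Poly (G f)) → TF n A → (∀ f g : Fin n, f ≠ g → ¬ CoAx (A f) (A g) → (3 / 2 : ℝ) ≤ c f g) → 6 * (2 : ℝ) ^ ((1 : ℝ) / 3) * (Real.sqrt 2 * Vol n G) ^ ((2 : ℝ) / 3) ≤ En n G A c m := by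
  intro Λ Brl Ax CoAx Φ Per ι W Dsc Tex En Vol Poly TF n G A c m hTex hPoly hTF hCh
  by_cases hdom : ∃ f₀ : Fin n, 29 / 50 * Vol n G ≤ (volume (⋃ g ∈ {g : Fin n | A g '' Λ = A f₀ '' Λ}, G g)).toReal
  · exact rung_dominant_charged_three_halves n G A c m hTex hPoly hTF hCh hdom
  classical
  obtain ⟨D, hD0, hP1, hP2, -, hV⟩ := twinFree_pincers_charged (3 / 2) n G A c m hTex hPoly hTF hCh
  set lat : Fin n → Set E3 := fun f => A f '' Λ with hlat
  set L : Finset (Set E3) := Finset.univ.image lat with hL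
  set v : Set E3 → ℝ := fun ℓ =>
    (volume (⋃ f ∈ Finset.univ.filter (fun f => lat f = ℓ), G f)).toReal with hv
  have hvnn : ∀ ℓ ∈ L, 0 ≤ v ℓ := fun ℓ _ => ENNReal.toReal_nonneg
  have hset : ∀ f₀, (⋃ f ∈ Finset.univ.filter (fun f => lat f = lat f₀), G f) =
      ⋃ g ∈ {g : Fin n | A g '' Λ = A f₀ '' Λ}, G g := by
    intro f₀
    ext x
    simp only [Set.mem_iUnion, Finset.mem_filter, Finset.mem_univ, true_and, Set.mem_setOf_eq,
      exists_prop, hlat]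
  have hnd : ∀ ℓ ∈ L, v ℓ < 29 / 50 * Vol n G := by
    intro ℓ hℓ
    obtain ⟨f₀, -, rfl⟩ := Finset.mem_image.1 hℓ
    by_contra h
    exact hdom ⟨f₀, by rw [← hset f₀]; exact not_lt.1 h⟩
  have hV' : Vol n G = ∑ ℓ ∈ L, v ℓ := hV
  have hbulk : (1.25 : ℝ) * (Vol n G) ^ ((2 : ℝ) / 3) ≤ ∑ ℓ ∈ L, v ℓ ^ ((2 : ℝ) / 3) :=
    sum_rpow_two_thirds_ge_of_noDominant_29_50 L hV' hvnn hnd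
  -- the bulk corner at charge `3/2`
  obtain ⟨hfin, hdisj, -, -, -⟩ := hTex
  obtain ⟨hEm, hEv, hEp, -⟩ := texture_union_facts G hfin hdisj
  have hiso : 3 * (Real.pi * 4 / 3) ^ ((1 : ℝ) / 3) * (Vol n G) ^ ((2 : ℝ) / 3) ≤
      (perimeter (⋃ f, G f)).toReal := isoperimetric_toReal_three hEm hEv hEp
  have hVnn : 0 ≤ Vol n G := ENNReal.toReal_nonneg
  have hP1' : Real.sqrt 3 * (perimeter (⋃ f, G f)).toReal + 3 / 2 / 2 * D ≤ En n G A c m := hP1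
  have h1' : Real.sqrt 3 * (perimeter (⋃ f, G f)).toReal + 3 / 4 * D ≤ En n G A c m := by
    linarith
  have hP2' : (∑ ℓ ∈ L, 6 * (2 : ℝ) ^ ((1 : ℝ) / 3) * (Real.sqrt 2 * v ℓ) ^ ((2 : ℝ) / 3)) -
      (Real.sqrt 5 - 3 / 2 / 2) * D ≤ En n G A c m := hP2
  have h2' : (∑ ℓ ∈ L, 6 * (2 : ℝ) ^ ((1 : ℝ) / 3) * (Real.sqrt 2 * v ℓ) ^ ((2 : ℝ) / 3)) -
      (Real.sqrt 5 - 3 / 4) * D ≤ En n G A c m := by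
    linarith
  exact bulk_pincer_arith_three_halves L isoConst_three_pos (le_of_eq isoConst_three_cube.symm) hVnn
    hvnn hbulk hiso hD0 h1' h2'

end Summit.Ventures.Crystal3D.Cruxes.PolycrystalWulffBound.PolyDensity

end
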